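import Literature.NumberTheory.LFunctions.SuzukiScrewLineEvenExtension
import Literature.NumberTheory.LFunctions.LagariasXiStructureFunctionProofs
import HarnessLib
import Summits.RiemannHypothesis.RiemannHypothesis.Theorems.WeilPositivity

/-!
# Suzuki's screw line over ALL real `t`: the repaired objects `𝔓ᴿ_t`, `𝔖ᴿ_t`, `P̂ᴿ_φ`, `‖·‖₀ᴿ` (cell row G-dbl-31)

LINE 1 — LABEL: RH-FREE corpus typing + RH-FREE proofs; the records `Suzuki2025_thm42R` (RH-CONSEQUENCE),
`Suzuki2025_thm14R` / `Suzuki2025_thm44R` / `Suzuki2025_cor15R` (RH-EQUIVALENT·PRINTED-REPAIRED, both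
directions printed) and `Suzuki2025_thm56_closureR` (RH-CONSEQUENCE) are STATEMENTS (named facts), never
targets. bears_on: B-C/B-P (LADDER-RH COLUMN 6 DBR). WHAT THIS IS NOT: typing the repaired criteria fixes
WHICH identity (`‖P̂ᴿ_{Dψ}‖² = π⟨ψ,ψ⟩_W` on `C_c^∞(ℝ)`) would prove RH through this door; it does not
move RH; no positivity or Hermite–Biehler property of `E_ξ` is asserted; nothing here bears on the
truth of RH.

SOURCE. M. Suzuki, *On the Hilbert space derived from the Weil distribution*, Canad. J. Math. 2025 =
arXiv:2301.00421v3 [Suzuki2025WeilHilbertSpace] (TeX line locators), §§1, 3.3, 4.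

## Why a repair (erratum E21 of the cell)

The paper sets "for negative `t`, `𝔖_t(z) := 𝔖_{−t}(z)`" (TeX l.359; `P_t := P_{−t}`, l.780). Typed
verbatim (`SuzukiScrewLine.lean`), this even extension makes `P̂_φ ≡ 0` for odd `φ`, whence CJM
Lemma 3.2 is false and Thm 1.4 / 4.2 / 4.4 / Cor 1.5 are equivalent to `¬RH` AS TYPED
(`SuzukiScrewLineEvenExtension.lean`: `Suzuki2025_lemma32_false`, `Suzuki2025_thm42_iff_not_riemannHypothesis`,
…). The paper's own (3.6)–(3.8), (4.4), (4.9) use instead the zero expansion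
`P_t(z) = Σ_γ m_γ (e^{−iγt} − 1)/(γ(z − γ))` for EVERY real `t`; since `Γ = −Γ` with multiplicities
(`ξ(s) = ξ(1−s)`), for `t < 0` this is `P_{|t|}(−z)`. Accordingly the REPAIRED objects are
`𝔓ᴿ_t(z) := 𝔓_t(z)` (`t ≥ 0`), `:= 𝔓_{|t|}(−z)` (`t < 0`); `𝔖ᴿ_t(z) := i(1 + Θ♯(z))/2 · 𝔓ᴿ_t(z)`
(CJM (1.5)); `P̂ᴿ_φ(z) := ∫ 𝔖ᴿ_t♯(z)φ(t)dt` (1.7); `‖ψ‖₀ᴿ := π^{−1/2}‖P̂ᴿ_{Dψ}‖` (3.9). With them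
(3.7) reads `P̂ᴿ_φ(x) = −(i/2)(1 + Θ(x)) Σ_γ m_γ c_γ(φ)/(γ(x − γ))`, `c_γ(φ) = ∫(e^{iγt} − 1)φ(t)dt`
`= φ̂(γ) − φ̂(0)` (both half-lines add up — the point of the repair), the subject of the row's sequel (modulo CJM Prop 3.1); here the objects, their `L²` theory and the
repaired records.

Useful identity (RH-FREE, proved): `E_ξ(−z) = E_ξ♯(z)`, hence `Θ(−z) = Θ(z)⁻¹` and, off the junk set,
**`𝔖ᴿ_t(z) = Θ♯(z) · 𝔖_{|t|}(−z)` for `t < 0`** (`screwLineR_of_neg`): on the real line `|Θ| = 1`, so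
`𝔖ᴿ_t ∈ L²(ℝ)` with the norm of `𝔖_{|t|}` (Prop 1.2ᴿ), and
`P̂ᴿ_φ(x) = P̂_{1_{[0,∞)}φ}(x) + Θ(x)·P̂_{1_{(0,∞)}φ(−·)}(−x)` a.e. (Prop 1.3ᴿ).

## Contents
* §A symmetries: `lagariasE_neg`, `sharp_lagariasE_neg`, `lagariasTheta_neg`, `sharp_lagariasTheta_neg`.
* §B objects: `screwPR`, `screwLineR`, `screwPhatR`, `screwNormZeroR`, `screwZeroExpansionR`,
  `IsVcircRepR`, `suzukiVcircR`, `screwK0R`; unfolding/compatibility lemmas (`screwLineR_of_nonneg`,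
  `screwLineR_of_neg`, `norm_screwLineR_ofReal`).
* §C Prop 1.2ᴿ `memLp_screwLineR`, Prop 1.3ᴿ `memLp_screwPhatR` (PROVED, RH-FREE).
* §D Lemma 3.2ᴿ: `Suzuki2025_lemma32R` (record) with (i) `Suzuki2025_lemma32R_subadd`, (ii)
  `Suzuki2025_lemma32R_absHom` PROVED and `Suzuki2025_lemma32R_of_definite` (⇐ (iii); (iii) modulo CJM
  Prop 3.1 = `Suzuki2025_lemma32R_iii_of_prop31`, sequel file of the row).
* §E records `Suzuki2025_thm42R`, `Suzuki2025_thm44R`, `Suzuki2025_thm14R`, `Suzuki2025_cor15R`,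
  `Suzuki2025_thm56_closureR` + the RH-free doors `Suzuki2025_thm44R_mpr`,
  `Suzuki2025_thm14R_if`, reductions `Suzuki2025_thm44R_of_onlyIf`, `Suzuki2025_thm14R_of_thm44R`,
  `Suzuki2025_cor43_mp_of_thm42R` (Cor 4.3 involves `t ≥ 0` only and needs no repair).

## References
* [Suzuki2025WeilHilbertSpace] M. Suzuki, Canad. J. Math. 2025 = arXiv:2301.00421v3, (1.5)–(1.9) TeX
  l.320–430, Lemma 3.2 l.1073–1093, (3.5)–(3.9) l.1019–1064, Thm 4.2 l.1182–1194, Cor 4.3 l.1250–1258,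
  Thm 4.4 l.1274–1284, Cor 1.5 l.438–451, Thm 5.6 l.1799–1809, Prop 3.1 l.789–793.
* Cell record E21 / G-dbl-31 (rh-crit/dbl), `SuzukiScrewLineEvenExtension.lean` (p445186).
-/

noncomputable section

open MeasureTheory Complex Filter Set Real
open Literature.Analysis.DeBrangesSpaces (sharp sharp_apply sharp_ofReal sharp_sharp)
open scoped ComplexConjugate Topology FourierTransform ENNReal InnerProductSpace

namespace Literature.NumberTheory.LFunctions

open ScrewLineEvenExtension ScrewLineL2

/-! ## A. Symmetries of `E_ξ` and `Θ_ξ` under `z ↦ −z` (RH-FREE) -/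

/-- **`E_ξ(−z) = E_ξ♯(z)`**: `ξ(½ + iz) + ξ′(½ + iz) = ξ(½ − iz) − ξ′(½ − iz)` by `ξ(s) = ξ(1−s)`.
RH-FREE. [cite: Suzuki2025WeilHilbertSpace, (1.3)–(1.4) (TeX l.262–275) with ξ(s) = ξ(1−s)] -/
theorem lagariasE_neg (z : ℂ) : lagariasE (-z) = sharp lagariasE z := by
  rw [sharp_lagariasE]
  unfold lagariasE
  have e : (1 / 2 : ℂ) - I * -z = 1 - (1 / 2 - I * z) := by ring
  rw [e, riemannXi_one_sub, deriv_riemannXi_one_sub]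
  ring

/-- `E_ξ♯(−z) = E_ξ(z)`. RH-FREE. [cite: Suzuki2025WeilHilbertSpace, (1.3)–(1.4) (TeX l.262–275)] -/
theorem sharp_lagariasE_neg (z : ℂ) : sharp lagariasE (-z) = lagariasE z := by
  rw [sharp_apply, map_neg, lagariasE_neg, sharp_apply, Complex.conj_conj, Complex.conj_conj]

/-- **`Θ_ξ(−z) = Θ_ξ(z)⁻¹`** (for every `z`, junk values included: `Θ = E♯/E` and `E(−z) = E♯(z)`).
RH-FREE. [cite: Suzuki2025WeilHilbertSpace, (1.4) (TeX l.270–275)] -/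
theorem lagariasTheta_neg (z : ℂ) : lagariasTheta (-z) = (lagariasTheta z)⁻¹ := by
  unfold lagariasTheta
  rw [sharp_lagariasE_neg, lagariasE_neg, inv_div]

/-- `Θ_ξ♯(−z) = Θ_ξ♯(z)⁻¹`. RH-FREE. [cite: Suzuki2025WeilHilbertSpace, (1.4) (TeX l.270–275)] -/
theorem sharp_lagariasTheta_neg (z : ℂ) : sharp lagariasTheta (-z) = (sharp lagariasTheta z)⁻¹ := by
  simp only [sharp_apply, map_neg, lagariasTheta_neg, map_inv₀]

/-! ## B. The repaired objects -/

/-- RH-FREE object. **`𝔓ᴿ_t(z)`** — the function (1.6) for `t ≥ 0`, and for `t < 0` the value dictated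
by the zero expansion (3.2) with `e^{−iγt}` for every real `t`: `𝔓ᴿ_t(z) := 𝔓_{|t|}(−z)` (by the
symmetry `γ ↦ −γ` of `Γ`, `Σ m_γ(e^{−iγt}−1)/(γ(z−γ)) = P_{|t|}(−z)` for `t < 0`). Replaces the
printed even extension (TeX l.359/l.780, erratum E21). (`screwP t` is already even in `t`.)
[cite: Suzuki2025WeilHilbertSpace, eq. (1.6) (TeX l.325–345) and (3.2)/(3.6) (l.768–781, l.1026–1032); erratum E21] -/
def screwPR (t : ℝ) (z : ℂ) : ℂ :=
  if 0 ≤ t then screwP t z else screwP t (-z)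

/-- RH-FREE object. **The repaired screw line `𝔖ᴿ_t(z) := i(1 + Θ_ξ♯(z))/2 · 𝔓ᴿ_t(z)`** (CJM (1.5)
over `𝔓ᴿ`), for every real `t`. [cite: Suzuki2025WeilHilbertSpace, eq. (1.5) (TeX l.320–323); erratum E21] -/
def screwLineR (t : ℝ) (z : ℂ) : ℂ :=
  I * (1 + sharp lagariasTheta z) / 2 * screwPR t z

/-- RH-FREE object. **`P̂ᴿ_φ(z) := ∫ 𝔖ᴿ_t♯(z) φ(t) dt`** (CJM (1.7) over the repaired screw line).
[cite: Suzuki2025WeilHilbertSpace, eq. (1.7) (TeX l.395–405); erratum E21] -/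
def screwPhatR (φ : ℝ → ℂ) (z : ℂ) : ℂ :=
  ∫ t : ℝ, sharp (screwLineR t) z * φ t

/-- RH-FREE object. **`‖ψ‖₀ᴿ := π^{−1/2}‖P̂ᴿ_{Dψ}‖_{L²(ℝ)}`** (CJM (3.9) over the repaired objects),
written `√((∫‖P̂ᴿ_{Dψ}‖²)/π)`. [cite: Suzuki2025WeilHilbertSpace, eq. (3.9) (TeX l.1058–1064); erratum E21] -/
def screwNormZeroR (ψ : ℝ → ℂ) : ℝ :=
  Real.sqrt ((∫ x : ℝ, ‖screwPhatR (suzukiD ψ) x‖ ^ 2) / Real.pi)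

/-- RH-FREE object. **The zero expansion `P_t(z) = Σ_γ m_γ (e^{−iγt} − 1)/γ · 1/(z − γ)` for EVERY real
`t`** (CJM (3.2) without the even extension; `screwZeroExpansion t` is its value at `|t|`).
[cite: Suzuki2025WeilHilbertSpace, eq. (3.2) (TeX l.768–781); erratum E21] -/
def screwZeroExpansionR (t : ℝ) (z : ℂ) : ℂ :=
  ∑' ρ : ZetaZeros.riemannZetaNontrivialZeros,
    (riemannZetaZeroOrder (ρ : ℂ) : ℂ) *
      ((cexp (-(I * suzukiZeroParam ρ * t)) - 1) / suzukiZeroParam ρ) *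
      (1 / (z - suzukiZeroParam ρ))

/-- RH-FREE object. `𝓚₀ᴿ` := the `L²(ℝ)`-closure of `P̂ᴿ_D(C_c^∞(ℝ))` (CJM §3.3 over the repaired
objects). [cite: Suzuki2025WeilHilbertSpace, §3.3 (TeX l.1095–1107); erratum E21] -/
def screwK0R : Set (Lp ℂ 2 (volume : Measure ℝ)) :=
  closure {F | ∃ ψ : ℝ → ℂ, IsWeilTest ψ ∧ (F : ℝ → ℂ) =ᵐ[volume] fun x ↦ screwPhatR (suzukiD ψ) x}

/-- RH-FREE. "`ψ ∈ L²(ℝ)` is the element of `V°(0)` generated by the test function `ψ₀`":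
`𝖥ψ = P̂ᴿ_{Dψ₀}` in Suzuki's normalisation, written with Mathlib's `𝓕` on `L²` exactly as the cell's
`IsVcircRep` (`(𝓕ψ)(ξ) = P̂ᴿ_{Dψ₀}(−2πξ)` a.e.). [cite: Suzuki2025WeilHilbertSpace, Cor. 1.5 (TeX l.438–444); erratum E21] -/
def IsVcircRepR (ψ₀ : ℝ → ℂ) (ψ : Lp ℂ 2 (volume : Measure ℝ)) : Prop :=
  ((𝓕 ψ : Lp ℂ 2 (volume : Measure ℝ)) : ℝ → ℂ) =ᵐ[volume]
    fun ξ : ℝ ↦ screwPhatR (suzukiD ψ₀) ((-(2 * Real.pi) * ξ : ℝ) : ℂ)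

/-- RH-FREE object. **`V°(0)ᴿ := {𝖥⁻¹P̂ᴿ_{Dψ} | ψ ∈ C_c^∞(ℝ)} ⊂ L²(ℝ)`** (CJM Cor. 1.5 over the repaired
objects). [cite: Suzuki2025WeilHilbertSpace, Cor. 1.5 (TeX l.438–444); erratum E21] -/
def suzukiVcircR : Set (Lp ℂ 2 (volume : Measure ℝ)) :=
  {ψ | ∃ ψ₀ : ℝ → ℂ, IsWeilTest ψ₀ ∧ IsVcircRepR ψ₀ ψ}

/-! ### Unfolding and the reflection identity -/

/-- `𝔓ᴿ_t = 𝔓_t` for `t ≥ 0`. [cite: Suzuki2025WeilHilbertSpace, eq. (1.6) (TeX l.325–345)] -/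
theorem screwPR_of_nonneg {t : ℝ} (ht : 0 ≤ t) (z : ℂ) : screwPR t z = screwP t z := by
  simp [screwPR, ht]

/-- `𝔓ᴿ_t(z) = 𝔓_{−t}(−z) = 𝔓_{|t|}(−z)` for `t < 0`. [cite: Suzuki2025WeilHilbertSpace, erratum E21 (TeX l.359/l.780 vs (3.6))] -/
theorem screwPR_of_neg {t : ℝ} (ht : t < 0) (z : ℂ) : screwPR t z = screwP (-t) (-z) := by
  simp [screwPR, not_le.2 ht, screwP_neg]

/-- `𝔖ᴿ_t = 𝔖_t` for `t ≥ 0`. [cite: Suzuki2025WeilHilbertSpace, eq. (1.5) (TeX l.320–323)] -/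
theorem screwLineR_of_nonneg {t : ℝ} (ht : 0 ≤ t) : screwLineR t = screwLine t := by
  funext z
  simp [screwLineR, screwLine, screwPR_of_nonneg ht]

/-- **Reflection identity: `𝔖ᴿ_t(z) = Θ♯(z) · 𝔖_{−t}(−z)` for `t < 0`**, wherever `Θ♯(z) ≠ 0` (i.e. off
the zeros of `E` and `E♯`): `1 + Θ♯(z) = Θ♯(z)(1 + Θ♯(−z))` by `Θ♯(−z) = Θ♯(z)⁻¹`. RH-FREE.
[cite: Suzuki2025WeilHilbertSpace, (1.5) with (1.4); erratum E21] -/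
theorem screwLineR_of_neg {t : ℝ} (ht : t < 0) {z : ℂ} (hz : sharp lagariasTheta z ≠ 0) :
    screwLineR t z = sharp lagariasTheta z * screwLine (-t) (-z) := by
  rw [screwLineR, screwPR_of_neg ht, screwLine, sharp_lagariasTheta_neg]
  field_simp
  ring

/-- At a point where `Θ♯(z) = 0` (junk: a zero of `E` or `E♯`) also `Θ♯(−z) = 0`, and
`𝔖ᴿ_t(z) = 𝔖_{−t}(−z)` for `t < 0`. [cite: Suzuki2025WeilHilbertSpace, (1.5); erratum E21] -/
theorem screwLineR_of_neg_of_eq_zero {t : ℝ} (ht : t < 0) {z : ℂ} (hz : sharp lagariasTheta z = 0) :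
    screwLineR t z = screwLine (-t) (-z) := by
  rw [screwLineR, screwPR_of_neg ht, screwLine, sharp_lagariasTheta_neg, hz]
  simp

/-- On the real line `Θ♯(x) = conj Θ(x)` has modulus `1` off the (Lebesgue-null, discrete) real zero
set of `E_ξ`, so **`‖𝔖ᴿ_t(x)‖ = ‖𝔖_{−t}(−x)‖` for `t < 0` and EVERY real `x`** (at the junk points both
prefactors degenerate together). RH-FREE. [cite: Suzuki2025WeilHilbertSpace, §3.2 (TeX l.985–990, "|Θ(z)| = 1 for z ∈ ℝ"); erratum E21] -/
theorem norm_screwLineR_of_neg {t : ℝ} (ht : t < 0) (x : ℝ) :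
    ‖screwLineR t x‖ = ‖screwLine (-t) (-(x : ℂ))‖ := by
  by_cases hz : sharp lagariasTheta (x : ℂ) = 0
  · rw [screwLineR_of_neg_of_eq_zero ht hz]
  · rw [screwLineR_of_neg ht hz, norm_mul]
    have hE : lagariasE (x : ℂ) ≠ 0 := by
      intro hE
      apply hz
      rw [sharp_ofReal, lagariasTheta, hE, div_zero, map_zero]
    rw [sharp_ofReal, Complex.norm_conj, norm_lagariasTheta_ofReal hE, one_mul]

/-- **Uniform majorant for the repaired screw line on the real line**: for `|t| ≤ R`,
`‖𝔖ᴿ_t(x)‖ ≤ K_R (1 + log(2+|x|))/(1+|x|)` for every real `x` (from the cell's Prop 1.2 bound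
`norm_screwLine_le_log_unif` and `norm_screwLineR_of_neg`). RH-FREE.
[cite: Suzuki2025WeilHilbertSpace, Prop. 1.2, proof §3.2 (TeX l.1005–1015); erratum E21] -/
theorem norm_screwLineR_le_log_unif (R : ℝ) :
    ∃ K : ℝ, 0 ≤ K ∧ ∀ t x : ℝ, |t| ≤ R →
      ‖screwLineR t x‖ ≤ K * ((1 + Real.log (2 + |x|)) / (1 + |x|)) := by
  obtain ⟨K, hK0, hK⟩ := norm_screwLine_le_log_unif R
  refine ⟨K, hK0, fun t x ht ↦ ?_⟩
  rcases le_or_gt 0 t with h0 | h0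
  · rw [screwLineR_of_nonneg h0]
    exact hK t x ht
  · rw [norm_screwLineR_of_neg h0]
    have h := hK (-t) (-x) (by rwa [abs_neg])
    rw [abs_neg] at h
    exact_mod_cast h

/-! ## C. Prop 1.2ᴿ and Prop 1.3ᴿ (RH-FREE, PROVED) -/

/-- Measurability of `x ↦ Θ_ξ♯(x) · 𝔖_{s}(−x)` on `ℝ`. [cite: Suzuki2025WeilHilbertSpace, Prop. 1.2 (TeX l.376–383)] -/
private theorem aestronglyMeasurable_reflected (s : ℝ) :
    AEStronglyMeasurable (fun x : ℝ ↦ sharp lagariasTheta (x : ℂ) * screwLine s (-(x : ℂ))) volume := by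
  have h1 : Measurable fun x : ℝ ↦ sharp lagariasTheta (x : ℂ) := by
    have : (fun x : ℝ ↦ sharp lagariasTheta (x : ℂ)) =
        fun x : ℝ ↦ (starRingEnd ℂ) (lagariasTheta (x : ℂ)) :=
      funext fun x ↦ sharp_ofReal _ _
    rw [this]
    exact Complex.continuous_conj.measurable.comp (measurable_lagariasTheta.comp Complex.measurable_ofReal)
  have h2 : Measurable fun x : ℝ ↦ screwLine s (-(x : ℂ)) := by
    have h' : Measurable fun x : ℝ ↦ screwLine s ((-x : ℝ) : ℂ) := by
      have hm : Measurable fun x : ℝ ↦ screwLine s (x : ℂ) := by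
        have := measurable_screwLine_uncurry'.comp (measurable_id.prodMk (measurable_const (a := s)))
        simpa only [Function.comp_def, id_eq] using this
      exact hm.comp measurable_neg
    simpa only [Complex.ofReal_neg] using h'
  exact (h1.mul h2).aestronglyMeasurable

/-- **Prop 1.2ᴿ: `𝔖ᴿ_t ∈ L²(ℝ)` for every real `t`** (for `t < 0` it has the norm of `𝔖_{|t|}`, by the
reflection identity and `|Θ| = 1` a.e. on `ℝ`). RH-FREE, PROVED.
[cite: Suzuki2025WeilHilbertSpace, Prop. 1.2 (TeX l.376–383); erratum E21] -/
theorem memLp_screwLineR (t : ℝ) : MemLp (fun x : ℝ ↦ screwLineR t x) 2 volume := by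
  rcases le_or_gt 0 t with h0 | h0
  · simp_rw [screwLineR_of_nonneg h0]
    exact memLp_screwLine t
  · -- reflected majorant in L²
    have hL : MemLp (fun x : ℝ ↦ screwLine (-t) ((-x : ℝ) : ℂ)) 2 volume :=
      (memLp_screwLine (-t)).comp_measurePreserving (Measure.measurePreserving_neg _)
    have hL' : MemLp (fun x : ℝ ↦ screwLine (-t) (-(x : ℂ))) 2 volume := by
      simpa only [Complex.ofReal_neg] using hL
    -- a.e. equality with the measurable reflected product
    have hae : (fun x : ℝ ↦ screwLineR t x) =ᵐ[volume]
        fun x ↦ sharp lagariasTheta (x : ℂ) * screwLine (-t) (-(x : ℂ)) := by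
      filter_upwards [ae_lagariasE_ofReal_ne_zero] with x hx
      have hz : sharp lagariasTheta (x : ℂ) ≠ 0 := by
        rw [sharp_ofReal, map_ne_zero, lagariasTheta]
        refine div_ne_zero ?_ hx
        rw [sharp_ofReal, map_ne_zero]; exact hx
      exact screwLineR_of_neg h0 hz
    refine MemLp.ae_eq hae.symm ?_
    refine MemLp.of_le_mul (c := 1) hL' (aestronglyMeasurable_reflected (-t)) (ae_of_all _ fun x ↦ ?_)
    rw [norm_mul, sharp_ofReal, Complex.norm_conj]
    have := norm_lagariasTheta_ofReal_le_one x
    nlinarith [norm_nonneg (screwLine (-t) (-(x : ℂ)))]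

/-- **Prop 1.2ᴿ as a named statement** (the repaired `Suzuki2025_prop12`), PROVED.
[cite: Suzuki2025WeilHilbertSpace, Prop. 1.2 (TeX l.376–383); erratum E21] -/
theorem Suzuki2025_prop12R : ∀ t : ℝ, MemLp (fun x : ℝ ↦ screwLineR t x) 2 volume :=
  memLp_screwLineR

/-- The half-line weights of a test function: `1_{[0,∞)}φ` and `1_{(0,∞)}φ(−·)` are measurable,
integrable and vanish off `{|t| ≤ R}`. [cite: Suzuki2025WeilHilbertSpace, (1.7) (TeX l.395–405)] -/
private theorem halfLine_weights {φ : ℝ → ℂ} (hφ : IsWeilTest φ) :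
    ∃ R : ℝ,
      (Measurable ((Ici (0 : ℝ)).indicator φ) ∧ Integrable ((Ici (0 : ℝ)).indicator φ) ∧
        ∀ t, R < |t| → (Ici (0 : ℝ)).indicator φ t = 0) ∧
      (Measurable ((Ioi (0 : ℝ)).indicator fun t ↦ φ (-t)) ∧
        Integrable ((Ioi (0 : ℝ)).indicator fun t ↦ φ (-t)) ∧
        ∀ t, R < |t| → (Ioi (0 : ℝ)).indicator (fun t ↦ φ (-t)) t = 0) := by
  obtain ⟨R, -, hR⟩ := hφ.2.exists_pos_le_norm
  have hφm : Measurable φ := hφ.1.continuous.measurable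
  have hφi : Integrable φ := hφ.1.continuous.integrable_of_hasCompactSupport hφ.2
  have hφn : IsWeilTest fun t ↦ φ (-t) := hφ.comp_neg
  have hφni : Integrable fun t ↦ φ (-t) := hφn.1.continuous.integrable_of_hasCompactSupport hφn.2
  refine ⟨R, ⟨hφm.indicator measurableSet_Ici, hφi.indicator measurableSet_Ici, fun t ht ↦ ?_⟩,
    ⟨(hφm.comp measurable_neg).indicator measurableSet_Ioi, hφni.indicator measurableSet_Ioi,
      fun t ht ↦ ?_⟩⟩
  · have : φ t = 0 := hR t (by rw [Real.norm_eq_abs]; exact ht.le)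
    simp [Set.indicator, this]
  · have : φ (-t) = 0 := hR (-t) (by rw [Real.norm_eq_abs, abs_neg]; exact ht.le)
    simp [Set.indicator, this]

/-- The integrand `t ↦ 𝔖ᴿ_t♯(x)φ(t)` of `P̂ᴿ_φ(x)` is integrable, for `φ ∈ C_c^∞(ℝ)` and EVERY real `x`.
[cite: Suzuki2025WeilHilbertSpace, (1.7) (TeX l.395–405); erratum E21] -/
theorem integrable_screwPhatR_integrand {φ : ℝ → ℂ} (hφ : IsWeilTest φ) (x : ℝ) :
    Integrable (fun t : ℝ ↦ sharp (screwLineR t) (x : ℂ) * φ t) := by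
  obtain ⟨R, -, hR⟩ := hφ.2.exists_pos_le_norm
  obtain ⟨K, hK0, hK⟩ := norm_screwLineR_le_log_unif R
  -- measurability in `t`: on `t ≥ 0` it is `𝔖_t`, on `t < 0` it is `c(x)·𝔖_{−t}(−x)` with a constant `c(x)`
  have hm₁ : Measurable fun t : ℝ ↦ screwLine t (x : ℂ) := measurable_screwLine_left x
  have hm₂ : Measurable fun t : ℝ ↦ screwLine (-t) (-(x : ℂ)) := by
    have h := measurable_screwLine_left (-x)
    have h' := h.comp measurable_neg
    simpa only [Function.comp_def, Complex.ofReal_neg] using h'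
  have hmeasR : Measurable fun t : ℝ ↦ screwLineR t (x : ℂ) := by
    by_cases hz : sharp lagariasTheta (x : ℂ) = 0
    · have : (fun t : ℝ ↦ screwLineR t (x : ℂ)) =
          fun t ↦ if 0 ≤ t then screwLine t (x : ℂ) else screwLine (-t) (-(x : ℂ)) := by
        funext t
        split_ifs with h
        · rw [screwLineR_of_nonneg h]
        · rw [screwLineR_of_neg_of_eq_zero (not_le.1 h) hz]
      rw [this]
      exact Measurable.ite measurableSet_Ici hm₁ hm₂
    · have : (fun t : ℝ ↦ screwLineR t (x : ℂ)) =
          fun t ↦ if 0 ≤ t then screwLine t (x : ℂ)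
            else sharp lagariasTheta (x : ℂ) * screwLine (-t) (-(x : ℂ)) := by
        funext t
        split_ifs with h
        · rw [screwLineR_of_nonneg h]
        · rw [screwLineR_of_neg (not_le.1 h) hz]
      rw [this]
      exact Measurable.ite measurableSet_Ici hm₁ (hm₂.const_mul _)
  have hmeas : AEStronglyMeasurable (fun t : ℝ ↦ sharp (screwLineR t) (x : ℂ) * φ t) volume := by
    have : (fun t : ℝ ↦ sharp (screwLineR t) (x : ℂ) * φ t) =
        fun t ↦ (starRingEnd ℂ) (screwLineR t (x : ℂ)) * φ t := funext fun t ↦ by rw [sharp_ofReal]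
    rw [this]
    exact ((Complex.continuous_conj.measurable.comp hmeasR).mul
      hφ.1.continuous.measurable).aestronglyMeasurable
  have hφi : Integrable (fun t : ℝ ↦ ‖φ t‖) :=
    (hφ.1.continuous.integrable_of_hasCompactSupport hφ.2).norm
  refine (hφi.const_mul (K * ((1 + Real.log (2 + |x|)) / (1 + |x|)))).mono' hmeas
    (ae_of_all _ fun t ↦ ?_)
  rw [norm_mul, sharp_ofReal, Complex.norm_conj]
  by_cases ht : |t| ≤ R
  · exact mul_le_mul_of_nonneg_right (hK t x ht) (norm_nonneg _)
  · have h0 : φ t = 0 := hR t (by rw [Real.norm_eq_abs]; linarith)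
    simp [h0]

/-- **`P̂ᴿ_φ` on the real line splits into the two half-lines**: for a.e. real `x`,
`P̂ᴿ_φ(x) = P̂_{1_{[0,∞)}φ}(x) + Θ_ξ(x) · P̂_{1_{(0,∞)}φ(−·)}(−x)` (reflection identity, `t ↦ −t` in the
second integral; `P̂` of the cell has the even kernel, so on half-line weights it is the plain
half-line integral). RH-FREE. [cite: Suzuki2025WeilHilbertSpace, (1.7) (TeX l.395–405); erratum E21] -/
theorem screwPhatR_ae_eq_halfLines {φ : ℝ → ℂ} (hφ : IsWeilTest φ) :
    (fun x : ℝ ↦ screwPhatR φ x) =ᵐ[volume] fun x ↦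
      screwPhat ((Ici (0 : ℝ)).indicator φ) x +
        lagariasTheta x * screwPhat ((Ioi (0 : ℝ)).indicator fun t ↦ φ (-t)) (-(x : ℂ)) := by
  obtain ⟨R, ⟨hmp, hip, hRp⟩, ⟨hmn, hin, hRn⟩⟩ := halfLine_weights hφ
  filter_upwards [ae_lagariasE_ofReal_ne_zero] with x hx
  have hz : sharp lagariasTheta (x : ℂ) ≠ 0 := by
    rw [sharp_ofReal, map_ne_zero, lagariasTheta]
    refine div_ne_zero ?_ hx
    rw [sharp_ofReal, map_ne_zero]; exact hx
  -- split the integrand pointwise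
  have hsplit : ∀ t : ℝ, sharp (screwLineR t) (x : ℂ) * φ t =
      sharp (screwLine t) (x : ℂ) * (Ici (0 : ℝ)).indicator φ t +
        lagariasTheta x * (sharp (screwLine (-t)) (-(x : ℂ)) *
          (Ioi (0 : ℝ)).indicator (fun s ↦ φ (-s)) (-t)) := by
    intro t
    rcases le_or_gt 0 t with h0 | h0
    · have h1 : (Ioi (0 : ℝ)).indicator (fun s ↦ φ (-s)) (-t) = 0 := by
        rw [Set.indicator_of_notMem]; simp [h0]
      rw [h1, screwLineR_of_nonneg h0, Set.indicator_of_mem (by exact h0)]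
      ring
    · have h1 : (Ici (0 : ℝ)).indicator φ t = 0 := by
        rw [Set.indicator_of_notMem]; simp [h0]
      have h2 : (Ioi (0 : ℝ)).indicator (fun s ↦ φ (-s)) (-t) = φ t := by
        rw [Set.indicator_of_mem (by simp [h0])]; simp
      rw [h1, h2, mul_zero, zero_add]
      have e : sharp (screwLineR t) (x : ℂ) =
          lagariasTheta x * sharp (screwLine (-t)) (-(x : ℂ)) := by
        rw [sharp_ofReal, screwLineR_of_neg h0 hz, map_mul, sharp_ofReal, Complex.conj_conj,
          sharp_apply, map_neg, Complex.conj_ofReal]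
      rw [e]; ring
  have hI₁ : Integrable fun t : ℝ ↦ sharp (screwLine t) (x : ℂ) * (Ici (0 : ℝ)).indicator φ t :=
    integrable_screwPhat_integrand_of_support hmp hip hRp x
  have hI₂' : Integrable fun s : ℝ ↦
      sharp (screwLine s) ((-x : ℝ) : ℂ) * (Ioi (0 : ℝ)).indicator (fun s ↦ φ (-s)) s :=
    integrable_screwPhat_integrand_of_support hmn hin hRn (-x)
  have hI₂ : Integrable fun t : ℝ ↦
      sharp (screwLine (-t)) (-(x : ℂ)) * (Ioi (0 : ℝ)).indicator (fun s ↦ φ (-s)) (-t) := by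
    have h := hI₂'.comp_neg
    simpa only [Function.comp_def, Complex.ofReal_neg] using h
  unfold screwPhatR screwPhat
  rw [integral_congr_ae (ae_of_all _ hsplit), integral_add hI₁ (hI₂.const_mul _), integral_const_mul]
  congr 1
  rw [show ((-x : ℝ) : ℂ) = -(x : ℂ) from Complex.ofReal_neg x] at hI₂'
  congr 1
  have h := integral_neg_eq_self
    (fun t : ℝ ↦ sharp (screwLine t) (-(x : ℂ)) * (Ioi (0 : ℝ)).indicator (fun s ↦ φ (-s)) t) volume
  simpa only using h

/-- **Prop 1.3ᴿ: `P̂ᴿ_φ ∈ L²(ℝ)` for every `φ ∈ C_c^∞(ℝ)`** (the two half-line pieces are in `L²` by the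
Prop 1.3 majorant for bounded-support weights, `|Θ| ≤ 1` on `ℝ`). RH-FREE, PROVED.
[cite: Suzuki2025WeilHilbertSpace, Prop. 1.3 (TeX l.392–405); erratum E21] -/
theorem memLp_screwPhatR {φ : ℝ → ℂ} (hφ : IsWeilTest φ) :
    MemLp (fun x : ℝ ↦ screwPhatR φ x) 2 volume := by
  obtain ⟨R, ⟨hmp, hip, hRp⟩, ⟨hmn, hin, hRn⟩⟩ := halfLine_weights hφ
  have h₁ : MemLp (fun x : ℝ ↦ screwPhat ((Ici (0 : ℝ)).indicator φ) x) 2 volume :=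
    memLp_screwPhat_of_support hmp hip hRp
  have h₂' : MemLp (fun x : ℝ ↦ screwPhat ((Ioi (0 : ℝ)).indicator fun t ↦ φ (-t)) x) 2 volume :=
    memLp_screwPhat_of_support hmn hin hRn
  have h₂ : MemLp (fun x : ℝ ↦
      screwPhat ((Ioi (0 : ℝ)).indicator fun t ↦ φ (-t)) (-(x : ℂ))) 2 volume := by
    have h := h₂'.comp_measurePreserving (Measure.measurePreserving_neg _)
    simpa only [Function.comp_def, Complex.ofReal_neg] using h
  have hΘm : AEStronglyMeasurable (fun x : ℝ ↦ lagariasTheta (x : ℂ)) volume :=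
    (measurable_lagariasTheta.comp Complex.measurable_ofReal).aestronglyMeasurable
  have h₃ : MemLp (fun x : ℝ ↦ lagariasTheta x *
      screwPhat ((Ioi (0 : ℝ)).indicator fun t ↦ φ (-t)) (-(x : ℂ))) 2 volume := by
    refine MemLp.of_le_mul (c := 1) h₂ (hΘm.mul h₂.1) (ae_of_all _ fun x ↦ ?_)
    rw [norm_mul]
    have := norm_lagariasTheta_ofReal_le_one x
    nlinarith [norm_nonneg (screwPhat ((Ioi (0 : ℝ)).indicator fun t ↦ φ (-t)) (-(x : ℂ)))]
  exact MemLp.ae_eq (screwPhatR_ae_eq_halfLines hφ).symm (h₁.add h₃)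

/-- **Prop 1.3ᴿ as a named statement** (the repaired `Suzuki2025_prop13`), PROVED.
[cite: Suzuki2025WeilHilbertSpace, Prop. 1.3 (TeX l.392–405); erratum E21] -/
theorem Suzuki2025_prop13R :
    ∀ φ : ℝ → ℂ, IsWeilTest φ → MemLp (fun x : ℝ ↦ screwPhatR φ x) 2 volume :=
  fun _ hφ ↦ memLp_screwPhatR hφ

/-! ## D. Lemma 3.2ᴿ -/

/-- RH-FREE · **CJM Lemma 3.2 (repaired, E21)**: (3.9)ᴿ defines a norm on `C_c^∞(ℝ)` — subadditive,
absolutely homogeneous, and definite. (i),(ii): `Suzuki2025_lemma32R_subadd/_absHom` below; (iii) is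
the row's sequel `Suzuki2025_lemma32R_iii_of_prop31` (modulo CJM Prop 3.1; printed proof: `P̂ᴿ_{Dψ} ≡ 0` forces
`ψ̂(γ) = 0` for all `γ ∈ Γ` by (3.5)/(3.8), hence `ψ = 0` by [Su22, Lemma 2.1] = `Suzuki2023_lemma21`).
[cite: Suzuki2025WeilHilbertSpace, Lemma 3.2 (TeX l.1073–1093); erratum E21] -/
def Suzuki2025_lemma32R : Prop :=
  (∀ ψ₁ ψ₂ : ℝ → ℂ, IsWeilTest ψ₁ → IsWeilTest ψ₂ →
      screwNormZeroR (ψ₁ + ψ₂) ≤ screwNormZeroR ψ₁ + screwNormZeroR ψ₂) ∧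
    (∀ (k : ℂ) (ψ : ℝ → ℂ), IsWeilTest ψ → screwNormZeroR (k • ψ) = ‖k‖ * screwNormZeroR ψ) ∧
    ∀ ψ : ℝ → ℂ, IsWeilTest ψ → screwNormZeroR ψ = 0 → ψ = 0

/-- `D(ψ₁ + ψ₂) = Dψ₁ + Dψ₂` for smooth `ψᵢ`. [cite: Suzuki2025WeilHilbertSpace, (1.8) (TeX l.412–416)] -/
private theorem suzukiD_add' {ψ₁ ψ₂ : ℝ → ℂ} (h₁ : IsWeilTest ψ₁) (h₂ : IsWeilTest ψ₂) :
    suzukiD (ψ₁ + ψ₂) = suzukiD ψ₁ + suzukiD ψ₂ := by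
  funext t
  simp only [suzukiD, Pi.add_apply]
  rw [deriv_add (h₁.1.differentiable (by simp) t) (h₂.1.differentiable (by simp) t)]
  ring

/-- `D(kψ) = k·Dψ`. [cite: Suzuki2025WeilHilbertSpace, (1.8) (TeX l.412–416)] -/
private theorem suzukiD_smul' (ψ : ℝ → ℂ) (k : ℂ) :
    suzukiD (k • ψ) = fun t ↦ k * suzukiD ψ t := by
  funext t
  simp only [suzukiD]
  rw [show k • ψ = fun y ↦ k * ψ y from rfl, deriv_const_mul_field']
  ring

/-- `P̂ᴿ_{kφ} = k P̂ᴿ_φ` (no hypotheses). [cite: Suzuki2025WeilHilbertSpace, (1.7) (TeX l.395–405)] -/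
theorem screwPhatR_const_mul (φ : ℝ → ℂ) (k : ℂ) (z : ℂ) :
    screwPhatR (fun t ↦ k * φ t) z = k * screwPhatR φ z := by
  unfold screwPhatR
  rw [← integral_const_mul]
  congr 1 with t
  ring

/-- `P̂ᴿ_{φ₁+φ₂}(x) = P̂ᴿ_{φ₁}(x) + P̂ᴿ_{φ₂}(x)` for test `φᵢ` and every real `x`.
[cite: Suzuki2025WeilHilbertSpace, (1.7) (TeX l.395–405)] -/
theorem screwPhatR_add {φ₁ φ₂ : ℝ → ℂ} (h₁ : IsWeilTest φ₁) (h₂ : IsWeilTest φ₂) (x : ℝ) :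
    screwPhatR (φ₁ + φ₂) x = screwPhatR φ₁ x + screwPhatR φ₂ x := by
  unfold screwPhatR
  rw [← integral_add (integrable_screwPhatR_integrand h₁ x) (integrable_screwPhatR_integrand h₂ x)]
  congr 1 with t
  simp only [Pi.add_apply]
  ring

/-- `‖hf.toLp f‖_{L²} = (∫‖f‖²)^{1/2}`. [cite: Suzuki2025WeilHilbertSpace, (3.9) (TeX l.1058–1064)] -/
private theorem norm_toLp_two_eq_sqrt' {f : ℝ → ℂ} (hf : MemLp f 2 volume) :
    ‖hf.toLp f‖ = Real.sqrt (∫ x, ‖f x‖ ^ 2) := by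
  rw [Lp.norm_toLp, hf.eLpNorm_eq_integral_rpow_norm two_ne_zero ENNReal.ofNat_ne_top,
    ENNReal.toReal_ofReal (by positivity), ENNReal.toReal_ofNat, Real.sqrt_eq_rpow,
    show ((2 : ℝ))⁻¹ = 1 / 2 by norm_num]
  congr 1
  refine integral_congr_ae (ae_of_all _ fun x ↦ ?_)
  simp

/-- **CJM Lemma 3.2 (i), repaired**: `‖ψ₁ + ψ₂‖₀ᴿ ≤ ‖ψ₁‖₀ᴿ + ‖ψ₂‖₀ᴿ` on `C_c^∞(ℝ)` (Minkowski in `L²(ℝ)`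
by Prop 1.3ᴿ and linearity of `ψ ↦ P̂ᴿ_{Dψ}`). RH-FREE, PROVED.
[cite: Suzuki2025WeilHilbertSpace, Lemma 3.2 (TeX l.1073–1079); erratum E21] -/
theorem Suzuki2025_lemma32R_subadd {ψ₁ ψ₂ : ℝ → ℂ} (h₁ : IsWeilTest ψ₁) (h₂ : IsWeilTest ψ₂) :
    screwNormZeroR (ψ₁ + ψ₂) ≤ screwNormZeroR ψ₁ + screwNormZeroR ψ₂ := by
  have hD₁ : IsWeilTest (suzukiD ψ₁) := h₁.suzukiD
  have hD₂ : IsWeilTest (suzukiD ψ₂) := h₂.suzukiD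
  have hf₁ := memLp_screwPhatR hD₁
  have hf₂ := memLp_screwPhatR hD₂
  have hpt : ∀ x : ℝ, screwPhatR (suzukiD (ψ₁ + ψ₂)) x =
      screwPhatR (suzukiD ψ₁) x + screwPhatR (suzukiD ψ₂) x := fun x ↦ by
    rw [suzukiD_add' h₁ h₂, screwPhatR_add hD₁ hD₂]
  unfold screwNormZeroR
  simp only [hpt]
  rw [Real.sqrt_div' _ Real.pi_pos.le, Real.sqrt_div' _ Real.pi_pos.le,
    Real.sqrt_div' _ Real.pi_pos.le, ← add_div]
  gcongr
  have e : Real.sqrt (∫ x : ℝ, ‖screwPhatR (suzukiD ψ₁) x + screwPhatR (suzukiD ψ₂) x‖ ^ 2) =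
      ‖(hf₁.add hf₂).toLp _‖ := by
    rw [norm_toLp_two_eq_sqrt']; rfl
  rw [e, MemLp.toLp_add, ← norm_toLp_two_eq_sqrt' hf₁, ← norm_toLp_two_eq_sqrt' hf₂]
  exact norm_add_le _ _

/-- **CJM Lemma 3.2 (ii), repaired**: `‖kψ‖₀ᴿ = |k|‖ψ‖₀ᴿ`. RH-FREE, PROVED.
[cite: Suzuki2025WeilHilbertSpace, Lemma 3.2 (TeX l.1073–1079); erratum E21] -/
theorem Suzuki2025_lemma32R_absHom (k : ℂ) (ψ : ℝ → ℂ) :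
    screwNormZeroR (k • ψ) = ‖k‖ * screwNormZeroR ψ := by
  have hpt : ∀ x : ℝ, screwPhatR (suzukiD (k • ψ)) x = k * screwPhatR (suzukiD ψ) x := fun x ↦ by
    rw [suzukiD_smul' ψ k, screwPhatR_const_mul]
  unfold screwNormZeroR
  simp only [hpt, norm_mul, mul_pow]
  rw [integral_const_mul, mul_div_assoc, Real.sqrt_mul (sq_nonneg _), Real.sqrt_sq (norm_nonneg _)]

/-- **CJM Lemma 3.2 (repaired) reduced to definiteness (iii)** — with (i),(ii) proved here, the record
`Suzuki2025_lemma32R` follows from `‖ψ‖₀ᴿ = 0 ⇒ ψ = 0` on `C_c^∞(ℝ)` (the row's sequel, modulo CJM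
Prop 3.1). [cite: Suzuki2025WeilHilbertSpace, Lemma 3.2 (TeX l.1073–1093); erratum E21] -/
theorem Suzuki2025_lemma32R_of_definite
    (h3 : ∀ ψ : ℝ → ℂ, IsWeilTest ψ → screwNormZeroR ψ = 0 → ψ = 0) : Suzuki2025_lemma32R :=
  ⟨fun _ _ h₁ h₂ ↦ Suzuki2025_lemma32R_subadd h₁ h₂, fun k ψ _ ↦ Suzuki2025_lemma32R_absHom k ψ, h3⟩

/-! ## E. The repaired records and their RH-free doors -/

/-- RH-CONSEQUENCE (printed "Assume the RH is true"): **CJM Thm 4.2, repaired (E21)**. Under RH,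
`t ↦ π^{−1/2}𝔖ᴿ_t` (`ℝ → L²(ℝ)`) is a screw line of `g_ξ`: `(1/π)⟨𝔖ᴿ_t, 𝔖ᴿ_u⟩ = G_g(t,u)` (4.4) for all
real `t, u` (`G_g = zetaScrewKernel`), and the Kreĭn–Langer screw-line property (§2.1) for the
`L²`-classes (which exist unconditionally, Prop 1.2ᴿ `memLp_screwLineR`). Printed proof: (3.6) with `ℓ²`
coefficients, Prop 4.1, (4.9). A published theorem under RH; nobody's target.
[cite: Suzuki2025WeilHilbertSpace, Thm. 4.2 (TeX l.1182–1194); erratum E21] -/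
def Suzuki2025_thm42R : Prop :=
  RiemannHypothesis →
    (∀ t u : ℝ, (1 / Real.pi : ℂ) * ∫ x : ℝ, screwLineR t x * conj (screwLineR u x) =
        (zetaScrewKernel t u : ℂ)) ∧
      IsScrewLineFor
        (fun t ↦ ((Real.sqrt Real.pi)⁻¹ : ℂ) •
          ((memLp_screwLineR t).toLp _ : Lp ℂ 2 (volume : Measure ℝ)))
        (fun t u ↦ (zetaScrewKernel t u : ℂ))

/-- RH-EQUIVALENT (line 1)·PRINTED-REPAIRED (E21): **CJM Thm 4.4, repaired**. `RH ⟺` (4.7)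
`‖P̂ᴿ_φ‖² = π⟨φ,φ⟩_{G_g}` for all `φ ∈ C_c^∞(ℝ)` with `∫φ = 0`; and `RH ⟹` (4.7) for all
`φ ∈ C_c^∞(ℝ)` (`⟨φ,φ⟩_{G_g} = zetaScrewForm univ φ φ`). Directions in print: `⇒` by (3.7), Prop 4.1, (4.9);
`⇐` = Weil's criterion ([Yoshida 1992, Lemma 1]) — PROVED below as `Suzuki2025_thm44R_mpr`. A
refutation-budget statement; nobody's target. [cite: Suzuki2025WeilHilbertSpace, Thm. 4.4 (TeX l.1274–1284); erratum E21] -/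
def Suzuki2025_thm44R : Prop :=
  (RiemannHypothesis ↔ ∀ φ : ℝ → ℂ, IsWeilTest φ → ∫ t : ℝ, φ t = 0 →
      ((∫ x : ℝ, ‖screwPhatR φ x‖ ^ 2 : ℝ) : ℂ) = Real.pi * zetaScrewForm univ φ φ) ∧
    (RiemannHypothesis → ∀ φ : ℝ → ℂ, IsWeilTest φ →
      ((∫ x : ℝ, ‖screwPhatR φ x‖ ^ 2 : ℝ) : ℂ) = Real.pi * zetaScrewForm univ φ φ)

/-- RH-EQUIVALENT (line 1)·PRINTED-REPAIRED (E21): **CJM Thm 1.4, repaired** — the RH is true if and only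
if (1.9) `‖P̂ᴿ_{Dψ}‖²_{L²(ℝ)} = π⟨ψ,ψ⟩_W` for all `ψ ∈ C_c^∞(ℝ)` (`⟨ψ,ψ⟩_W = weilQuadratic ψ`, COLUMN 2).
Directions in print: `⇒` by Thm 4.4 and (4.10); `⇐` Weil's criterion — PROVED below as
`Suzuki2025_thm14R_if`. A refutation-budget statement; nobody's target.
[cite: Suzuki2025WeilHilbertSpace, Thm. 1.4 (TeX l.420–430); erratum E21] -/
def Suzuki2025_thm14R : Prop :=
  RiemannHypothesis ↔ ∀ ψ : ℝ → ℂ, IsWeilTest ψ →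
    ((∫ x : ℝ, ‖screwPhatR (suzukiD ψ) x‖ ^ 2 : ℝ) : ℂ) = Real.pi * weilQuadratic ψ

/-- RH-EQUIVALENT (line 1)·PRINTED-REPAIRED (E21): **CJM Cor 1.5, repaired** — with
`V°(0)ᴿ := {𝖥⁻¹P̂ᴿ_{Dψ} | ψ ∈ C_c^∞(ℝ)}`, the RH is true iff (1.10) `2‖ψ‖² = ⟨ψ₀,ψ₀⟩_W` for every
`ψ ∈ V°(0)ᴿ` and every generating test function `ψ₀` (the reading of `⟨ψ,ψ⟩_W` on `V°(0)` of the cell's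
`Suzuki2025_cor15`). A refutation-budget statement; nobody's target.
[cite: Suzuki2025WeilHilbertSpace, Cor. 1.5 (TeX l.438–451); erratum E21] -/
def Suzuki2025_cor15R : Prop :=
  RiemannHypothesis ↔
    ∀ ψ ∈ suzukiVcircR, ∀ ψ₀ : ℝ → ℂ, IsWeilTest ψ₀ → IsVcircRepR ψ₀ ψ →
      ((2 * ‖ψ‖ ^ 2 : ℝ) : ℂ) = weilQuadratic ψ₀

/-- RH-CONSEQUENCE: **CJM Thm 5.6, last clause, repaired (E21)** — under RH, `V(0)` is the
`L²`-closure of `V°(0)ᴿ`. A published theorem under RH; nobody's target.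
[cite: Suzuki2025WeilHilbertSpace, Thm. 5.6 (TeX l.1799–1809); erratum E21] -/
def Suzuki2025_thm56_closureR : Prop :=
  RiemannHypothesis → closure suzukiVcircR = suzukiV 0

/-! ### RH-free doors and reductions over the repaired objects -/

/-- RH-FREE DOOR: **CJM Thm 1.4 (repaired), `⟸`** — if (1.9)ᴿ holds for all `ψ ∈ C_c^∞(ℝ)` then
`⟨ψ,ψ⟩_W = π⁻¹‖P̂ᴿ_{Dψ}‖² ≥ 0` on `C_c^∞(ℝ)`, i.e. Weil positivity, whence RH (`weil_criterion_holds`).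
Unlike its even-extension twin `Suzuki2025_thm14_if`, the hypothesis here is not refuted.
[cite: Suzuki2025WeilHilbertSpace, Thm. 1.4 `⇐`, §4.3 (TeX l.1326–1345); erratum E21] -/
theorem Suzuki2025_thm14R_if
    (h : ∀ ψ : ℝ → ℂ, IsWeilTest ψ →
      ((∫ x : ℝ, ‖screwPhatR (suzukiD ψ) x‖ ^ 2 : ℝ) : ℂ) = Real.pi * weilQuadratic ψ) :
    RiemannHypothesis := by
  have hπ : (Real.pi : ℂ) ≠ 0 := Complex.ofReal_ne_zero.mpr Real.pi_ne_zero
  have hW : Summit.RiemannHypothesis.RiemannHypothesis.WeilPositivity := by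
    intro g hg
    have hq : weilQuadratic g =
        (((∫ x : ℝ, ‖screwPhatR (suzukiD g) x‖ ^ 2) / Real.pi : ℝ) : ℂ) := by
      rw [Complex.ofReal_div, eq_div_iff hπ, mul_comm]
      exact (h g hg).symm
    rw [hq, Complex.ofReal_re]
    exact div_nonneg (integral_nonneg fun _ ↦ by positivity) Real.pi_pos.le
  exact (show RiemannHypothesis ↔ Summit.RiemannHypothesis.RiemannHypothesis.WeilPositivity from weil_criterion_holds).mpr hW

/-- RH-FREE DOOR: **CJM Thm 4.4 (i) (repaired), `⟸`** — (4.7)ᴿ on mean-zero test functions gives, at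
`φ = ψ′`, `⟨ψ,ψ⟩_W = ⟨ψ′,ψ′⟩_{G_g} = π⁻¹‖P̂ᴿ_{ψ′}‖² ≥ 0` ((4.10), `zetaScrewForm_univ_deriv_eq_weilQuadratic`),
i.e. Weil positivity, whence RH. [cite: Suzuki2025WeilHilbertSpace, Thm. 4.4 (i) `⇐`, §4.3 (TeX l.1303–1345); erratum E21] -/
theorem Suzuki2025_thm44R_mpr
    (h : ∀ φ : ℝ → ℂ, IsWeilTest φ → ∫ t : ℝ, φ t = 0 →
      ((∫ x : ℝ, ‖screwPhatR φ x‖ ^ 2 : ℝ) : ℂ) = Real.pi * zetaScrewForm univ φ φ) :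
    RiemannHypothesis := by
  have hπ : (Real.pi : ℂ) ≠ 0 := Complex.ofReal_ne_zero.mpr Real.pi_ne_zero
  have hW : Summit.RiemannHypothesis.RiemannHypothesis.WeilPositivity := by
    intro g hg
    have hφ : IsWeilTest (deriv g) := hg.deriv
    have h47 := h (deriv g) hφ (integral_deriv_eq_zero_of_isWeilTest hg)
    rw [zetaScrewForm_univ_deriv_eq_weilQuadratic hg] at h47
    have hq : weilQuadratic g =
        (((∫ x : ℝ, ‖screwPhatR (deriv g) x‖ ^ 2) / Real.pi : ℝ) : ℂ) := by
      rw [Complex.ofReal_div, eq_div_iff hπ, mul_comm]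
      exact h47.symm
    rw [hq, Complex.ofReal_re]
    exact div_nonneg (integral_nonneg fun _ ↦ by positivity) Real.pi_pos.le
  exact (show RiemannHypothesis ↔ Summit.RiemannHypothesis.RiemannHypothesis.WeilPositivity from weil_criterion_holds).mpr hW

/-- RH-FREE REDUCTION: the repaired Thm 4.4 record follows from its RH-CONSEQUENCE clause (ii) alone.
[cite: Suzuki2025WeilHilbertSpace, Thm. 4.4, §4.3 (TeX l.1274–1345); erratum E21] -/
theorem Suzuki2025_thm44R_of_onlyIf
    (h : RiemannHypothesis → ∀ φ : ℝ → ℂ, IsWeilTest φ →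
      ((∫ x : ℝ, ‖screwPhatR φ x‖ ^ 2 : ℝ) : ℂ) = Real.pi * zetaScrewForm univ φ φ) :
    Suzuki2025_thm44R :=
  ⟨⟨fun hRH φ hφ _ ↦ h hRH φ hφ, fun h' ↦ Suzuki2025_thm44R_mpr h'⟩, h⟩

/-- RH-FREE REDUCTION: **CJM Thm 1.4 (repaired) from Thm 4.4 (repaired)** — clause (ii) at `φ = Dψ` and
(4.10) `⟨Dψ,Dψ⟩_{G_g} = ⟨ψ,ψ⟩_W` (`zetaScrewForm_univ_suzukiD`); `⇐` is `Suzuki2025_thm14R_if`.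
[cite: Suzuki2025WeilHilbertSpace, §4.3 (TeX l.1300–1345); erratum E21] -/
theorem Suzuki2025_thm14R_of_thm44R (h44 : Suzuki2025_thm44R) : Suzuki2025_thm14R := by
  refine ⟨fun hRH ψ hψ ↦ ?_, Suzuki2025_thm14R_if⟩
  have h := h44.2 hRH (suzukiD ψ) hψ.suzukiD
  rwa [zetaScrewForm_univ_suzukiD hψ] at h

/-- RH-FREE REDUCTION: Thm 1.4 (repaired) from Thm 4.2 is NOT restated (it needs (4.8)ᴿ by Fubini on
(4.4)ᴿ, the analogue of the cell's `Suzuki2025_thm44_mp_of_thm42`); recorded instead: **Cor 4.3 needs no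
repair** — its condition (4.6) quantifies over `t ≥ t₀ ≥ 0`, where `𝔖ᴿ_t = 𝔖_t`; the `⇒` half from the
repaired Thm 4.2: (4.4)ᴿ at `u = t ≥ 0`. [cite: Suzuki2025WeilHilbertSpace, Cor. 4.3 (TeX l.1250–1268); erratum E21] -/
theorem Suzuki2025_cor43_mp_of_thm42R (h42 : Suzuki2025_thm42R) (hRH : RiemannHypothesis) {t : ℝ}
    (ht : 0 ≤ t) : 1 / (2 * Real.pi) * ∫ x : ℝ, ‖screwLine t x‖ ^ 2 = zetaScrew t := by
  have h := (h42 hRH).1 t t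
  rw [zetaScrewKernel_self, screwLineR_of_nonneg ht] at h
  have hint : ∫ x : ℝ, screwLine t x * conj (screwLine t x) =
      ((∫ x : ℝ, ‖screwLine t x‖ ^ 2 : ℝ) : ℂ) := by
    rw [← integral_complex_ofReal]
    refine integral_congr_ae (Eventually.of_forall fun x ↦ ?_)
    simp only [Complex.mul_conj, Complex.normSq_eq_norm_sq, Complex.ofReal_pow]
  rw [hint] at h
  have h' : ((1 / Real.pi * ∫ x : ℝ, ‖screwLine t x‖ ^ 2 : ℝ) : ℂ) = ((2 * zetaScrew t : ℝ) : ℂ) := by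
    rw [← h]
    push_cast
    ring
  have h'' := Complex.ofReal_injective h'
  have hπ : Real.pi ≠ 0 := Real.pi_ne_zero
  rw [div_mul_eq_mul_div, one_mul, div_eq_iff hπ] at h''
  rw [h'', div_mul_eq_mul_div, one_mul, div_eq_iff (by positivity)]
  ring

/-- RH-FREE: **Cor 4.3 follows from the repaired Thm 4.2** (`⇒` above with `t₀ = 0`; `⇐` the cell's door
`Suzuki2025_cor43_mpr`). [cite: Suzuki2025WeilHilbertSpace, Cor. 4.3 (TeX l.1250–1268); erratum E21] -/
theorem Suzuki2025_cor43_of_thm42R (h42 : Suzuki2025_thm42R) : Suzuki2025_cor43 :=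
  ⟨fun hRH ↦ ⟨0, le_rfl, fun _ ht ↦ Suzuki2025_cor43_mp_of_thm42R h42 hRH ht⟩,
    fun h ↦ Suzuki2025_cor43_mpr h⟩

end Literature.NumberTheory.LFunctions
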